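import Summits.QuantumAdvantage.AdviceFreeQNC0.CubeCoverCounts
import Mathlib.Analysis.SpecificLimits.Normed
import HarnessLib

/-!
# Cell qa-qnc0 (rung F-Q1, route RingFrame, crux α, line `product`): `CubeCover` for every degree —
# dense subsets of a weight class mod 3 contain all positive vertices of a cube at every base point

Planner qa-qnc0-p1's THEOREM-TARGET T6(b) (HOME/qa-qnc0-p1/ROUND-8.md §1(b), Sketch9 §21.1(b), ask P7(b))
PROVED for ALL `D` and all `η > 0`: `cubeCover : 0 < η → CubeCover D η` — there is `L₀(D, η)` such
that for `L ≥ L₀`, every `r`, every `A ⊆ cls r` with `(2^{D+1} − 1)·#(cls r ∖ A) ≤ (1 − η)·#cls r`, and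
EVERY `x ∈ {0,1}^L`, some `a₁ … a_{D+1}` have `x + a_S ∈ A` for all `∅ ≠ S ⊆ [D+1]`
(`cubeCoverAll : CubeCoverAll`).  With `fsbDeg_of_cubeCover` (`CubeTransfer.lean`) this makes T6
unconditional (`CubeFSB.lean`).
Proof (ROUND-8 §1(b) with one change): let `N` = #generator matrices with all `M = 2^{D+1} − 1`
positive vertices in class `r` (`≥ 2^{(D+1)L}3^{−M}(1 − o(1))`, `CubeCoverCounts`).  If no cube at
`x` lands in `A`, every such matrix has a positive vertex in `B = cls r ∖ A`; by a CHANGE OF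
GENERATORS (`regen`, `CubeCoverSetup`: replace `a_i`, `i ∈ S`, by `a_S` — injective, vertex set
preserved) that vertex may be taken to be a generator vertex `x + a_i = y ∈ B`; pinning it leaves the
two-base-point family, whose count is `≤ 2^{DL}3^{−(M−1)}(1 + o(1))` unless `y` agrees or differs
with `x` in `< m₀` columns (`≤ 2m₀L^{m₀}` such `y`, `card_notMid_le`).  Summing,
`2^L(1 − o(1)) ≤ 3M·#B·(1 + o(1)) + o(2^L) ≤ (1 − η)(2^L + 2)(1 + o(1)) + o(2^L)`, false for `L` large.
WHAT THIS IS NOT: constants `2^{−Θ(D)}` (fixed-degree schema; NOT the constant-gap `RingHardLogDeg`,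
nothing at polylog degree); nothing on α; no separation claim.
-/

noncomputable section
noncomputable section

namespace Summit.QuantumAdvantage.AdviceFreeQNC0

namespace CubeChar

open Finset Filter

variable {L D : ℕ}

/-! ### The tail: base points agreeing or differing in few columns -/

/-- `#{u : |u| < m₀} ≤ m₀·L^{m₀}` (for `L ≥ 1`). -/
theorem card_filter_wt_lt_le (hL : 1 ≤ L) (m₀ : ℕ) :
    ((univ : Finset (Fin L → Bool)).filter fun u => wt u < m₀).card ≤ m₀ * L ^ m₀ := by
  classical
  have hsub : ((univ : Finset (Fin L → Bool)).filter fun u => wt u < m₀) ⊆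
      (Finset.range m₀).biUnion fun j => Literature.Computability.MetaComplexity.Hegedus.layer L j := by
    intro u hu
    rw [Finset.mem_filter] at hu
    exact Finset.mem_biUnion.2 ⟨wt u, Finset.mem_range.2 hu.2, Finset.mem_filter.2 ⟨Finset.mem_univ _, rfl⟩⟩
  refine (Finset.card_le_card hsub).trans ((Finset.card_biUnion_le).trans ?_)
  calc ∑ j ∈ Finset.range m₀, (Literature.Computability.MetaComplexity.Hegedus.layer L j).card
      ≤ ∑ _j ∈ Finset.range m₀, L ^ m₀ := Finset.sum_le_sum fun j hj => by
          rw [Literature.Computability.MetaComplexity.Hegedus.card_layer]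
          exact (Nat.choose_le_pow L j).trans
            (Nat.pow_le_pow_right hL (Finset.mem_range.1 hj).le)
    _ = m₀ * L ^ m₀ := by rw [Finset.sum_const, Finset.card_range, smul_eq_mul]

/-- The number of columns where `x` and `y` differ is the weight of `x ⊕ y`. -/
theorem card_filter_ne_eq_wt (x y : Fin L → Bool) :
    ((univ : Finset (Fin L)).filter fun ℓ => x ℓ ≠ y ℓ).card = wt (fun ℓ => xor (x ℓ) (y ℓ)) := by
  refine congrArg Finset.card (Finset.filter_congr fun ℓ _ => ?_)
  show x ℓ ≠ y ℓ ↔ xor (x ℓ) (y ℓ) = true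
  generalize x ℓ = p; generalize y ℓ = q; cases p <;> cases q <;> decide

/-- The number of columns where `x` and `y` agree is the weight of `¬x ⊕ y`. -/
theorem card_filter_eq_eq_wt (x y : Fin L → Bool) :
    ((univ : Finset (Fin L)).filter fun ℓ => x ℓ = y ℓ).card = wt (fun ℓ => xor (!x ℓ) (y ℓ)) := by
  refine congrArg Finset.card (Finset.filter_congr fun ℓ _ => ?_)
  show x ℓ = y ℓ ↔ xor (!x ℓ) (y ℓ) = true
  generalize x ℓ = p; generalize y ℓ = q; cases p <;> cases q <;> decide

/-- Translation invariance: `#{y : |x' ⊕ y| < m₀} = #{u : |u| < m₀}`. -/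
theorem card_filter_wt_xor_lt (x' : Fin L → Bool) (m₀ : ℕ) :
    ((univ : Finset (Fin L → Bool)).filter fun y => wt (fun ℓ => xor (x' ℓ) (y ℓ)) < m₀).card =
      ((univ : Finset (Fin L → Bool)).filter fun u => wt u < m₀).card := by
  rw [Finset.card_filter, Finset.card_filter]
  exact sum_comp_xorLeft x' (fun u => if wt u < m₀ then 1 else 0)

variable (L) in
/-- The MID base points: agreeing with `x` in `≥ m₀` columns and differing in `≥ m₀` columns. -/
def mid (x : Fin L → Bool) (m₀ : ℕ) : Finset (Fin L → Bool) :=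
  univ.filter fun y => m₀ ≤ ((univ : Finset (Fin L)).filter fun ℓ => x ℓ ≠ y ℓ).card ∧
    m₀ ≤ ((univ : Finset (Fin L)).filter fun ℓ => x ℓ = y ℓ).card

/-- The non-mid base points are few: `#(midᶜ) ≤ 2·m₀·L^{m₀}`. -/
theorem card_notMid_le (hL : 1 ≤ L) (x : Fin L → Bool) (m₀ : ℕ) :
    ((univ : Finset (Fin L → Bool)).filter fun y => y ∉ mid L x m₀).card ≤ 2 * (m₀ * L ^ m₀) := by
  have hsub : ((univ : Finset (Fin L → Bool)).filter fun y => y ∉ mid L x m₀) ⊆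
      ((univ : Finset (Fin L → Bool)).filter fun y => wt (fun ℓ => xor (x ℓ) (y ℓ)) < m₀) ∪
        ((univ : Finset (Fin L → Bool)).filter fun y => wt (fun ℓ => xor (!x ℓ) (y ℓ)) < m₀) := by
    intro y hy
    rw [Finset.mem_filter] at hy
    have h := hy.2
    unfold mid at h
    rw [Finset.mem_filter, not_and, not_and_or] at h
    rw [Finset.mem_union, Finset.mem_filter, Finset.mem_filter, ← card_filter_ne_eq_wt,
      ← card_filter_eq_eq_wt]
    rcases h (Finset.mem_univ _) with h | h
    · exact Or.inl ⟨Finset.mem_univ _, not_le.1 h⟩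
    · exact Or.inr ⟨Finset.mem_univ _, not_le.1 h⟩
  refine (Finset.card_le_card hsub).trans ((Finset.card_union_le _ _).trans ?_)
  rw [card_filter_wt_xor_lt, card_filter_wt_xor_lt, two_mul]
  exact Nat.add_le_add (card_filter_wt_lt_le hL m₀) (card_filter_wt_lt_le hL m₀)

/-! ### The union bound over the bad vertex -/

/-- If no cube at `x` has all positive vertices in `A`, every configuration of `goodCfg` has a
positive vertex in `B = cls r ∖ A`, which after a change of generators is a generator vertex; so
`#goodCfg ≤ Σ_S Σ_{y ∈ B} (pinned two-base-point count)`. -/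
theorem card_goodCfg_le_sum (x : Fin L → Bool) (r : ℕ) (A : Finset (Fin L → Bool))
    (H : ∀ a : Fin L → (Fin (D + 1) → Bool), ∃ S : Finset (Fin (D + 1)), S.Nonempty ∧ vert x a S ∉ A) :
    (goodCfg D x r).card ≤ ∑ S : PosSub D, ∑ y ∈ cls L r \ A,
      count (base2 (i := S.1.min' S.2) x y) read2 (dom2 (S.1.min' S.2) fun ℓ => xor (x ℓ) (y ℓ)) r := by
  classical
  set B := cls L r \ A with hB
  -- every good configuration has a bad positive vertex
  have hsub : goodCfg D x r ⊆ (univ : Finset (PosSub D)).biUnion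
      fun S => (goodCfg D x r).filter fun a => vert x a S.1 ∈ B := by
    intro a ha
    obtain ⟨S, hS, hSA⟩ := H a
    rw [Finset.mem_biUnion]
    refine ⟨⟨S, hS⟩, Finset.mem_univ _, Finset.mem_filter.2 ⟨ha, ?_⟩⟩
    have hcls : vert x a S ∈ cls L r := by
      unfold goodCfg at ha
      exact (Finset.mem_filter.1 ha).2 S hS
    exact Finset.mem_sdiff.2 ⟨hcls, hSA⟩
  refine (Finset.card_le_card hsub).trans (Finset.card_biUnion_le.trans (Finset.sum_le_sum
    fun S _ => ?_))
  set i := S.1.min' S.2 with hi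
  have hiS : i ∈ S.1 := Finset.min'_mem _ _
  -- change of generators: the bad vertex becomes the generator vertex `{i}`
  have h1 : ((goodCfg D x r).filter fun a => vert x a S.1 ∈ B).card ≤
      ((goodCfg D x r).filter fun a => vert x a {i} ∈ B).card := by
    refine Finset.card_le_card_of_injOn (regen S.1 i) ?_ ((regen_injective hiS).injOn)
    intro a ha
    have ha' := Finset.mem_filter.1 (Finset.mem_coe.1 ha)
    refine Finset.mem_coe.2 (Finset.mem_filter.2 ⟨regen_mem_goodCfg hiS ha'.1, ?_⟩)
    rw [vert_regen_singleton]
    exact ha'.2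
  -- fibre over the value `y` of the generator vertex
  have h2 : ((goodCfg D x r).filter fun a => vert x a {i} ∈ B).card =
      ∑ y ∈ B, (((goodCfg D x r).filter fun a => vert x a {i} ∈ B).filter
        fun a => vert x a {i} = y).card :=
    Finset.card_eq_sum_card_fiberwise fun a ha => (Finset.mem_filter.1 (Finset.mem_coe.1 ha)).2
  refine h1.trans (h2.le.trans (Finset.sum_le_sum fun y _ => ?_))
  refine le_trans (Finset.card_le_card fun a ha => ?_) (card_filter_goodCfg_pin_le_count x y i r)
  rw [Finset.mem_filter] at ha ⊢
  exact ⟨(Finset.mem_filter.1 ha.1).1, ha.2⟩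

/-- **The upper bound.** With `M = 2^{D+1} − 1` and `B = cls r ∖ A`:
`3^{M−1}·#goodCfg ≤ M·2^{DL}·(#B·(1 + 3^{M−1}(1 − 2^{−D})^{m₀}) + 3^{M−1}·2m₀L^{m₀})`. -/
theorem card_goodCfg_le (hL : 1 ≤ L) (x : Fin L → Bool) (r : ℕ) (A : Finset (Fin L → Bool)) (m₀ : ℕ)
    (H : ∀ a : Fin L → (Fin (D + 1) → Bool), ∃ S : Finset (Fin (D + 1)), S.Nonempty ∧ vert x a S ∉ A) :
    (3 : ℝ) ^ (2 ^ (D + 1) - 2) * ((goodCfg D x r).card : ℝ) ≤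
      ((2 ^ (D + 1) - 1 : ℕ) : ℝ) * (2 : ℝ) ^ (D * L) *
        (((cls L r \ A).card : ℝ) * (1 + (3 : ℝ) ^ (2 ^ (D + 1) - 2) * (1 - 1 / (2 : ℝ) ^ D) ^ m₀) +
          (3 : ℝ) ^ (2 ^ (D + 1) - 2) * (2 * (m₀ * (L : ℝ) ^ m₀))) := by
  classical
  set B := cls L r \ A with hB
  set E : ℝ := (3 : ℝ) ^ (2 ^ (D + 1) - 2) with hE
  set c₁ : ℝ := (2 : ℝ) ^ (D * L) * (1 + E * (1 - 1 / (2 : ℝ) ^ D) ^ m₀) with hc₁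
  set c₂ : ℝ := E * (2 : ℝ) ^ (D * L) with hc₂
  have hEpos : 0 < E := by positivity
  have hq0 : (0 : ℝ) ≤ 1 - 1 / (2 : ℝ) ^ D := by
    rw [sub_nonneg, div_le_one (by positivity)]; exact one_le_pow₀ (by norm_num)
  have hc₁nn : 0 ≤ c₁ := by positivity
  have hc₂nn : 0 ≤ c₂ := by positivity
  -- per base point `y`: the pinned count is `≤ c₁` on the mid points and `≤ c₂` elsewhere
  have hpt : ∀ (i : Fin (D + 1)) (y : Fin L → Bool),
      E * (count (base2 (i := i) x y) read2 (dom2 i fun ℓ => xor (x ℓ) (y ℓ)) r : ℝ) ≤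
        if y ∈ mid L x m₀ then c₁ else c₂ := by
    intro i y
    split_ifs with hy
    · unfold mid at hy
      obtain ⟨hne, heq⟩ := (Finset.mem_filter.1 hy).2
      exact three_pow_mul_count_pin_le x y i r m₀ hne heq
    · exact mul_le_mul_of_nonneg_left (count_pin_le_pow x y _ i r) hEpos.le
  -- sum over `y ∈ B`
  have hinner : ∀ i : Fin (D + 1),
      E * ∑ y ∈ B, (count (base2 (i := i) x y) read2 (dom2 i fun ℓ => xor (x ℓ) (y ℓ)) r : ℝ) ≤
        (B.card : ℝ) * c₁ + (2 * (m₀ * (L : ℝ) ^ m₀)) * c₂ := by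
    intro i
    rw [Finset.mul_sum]
    refine (Finset.sum_le_sum fun y _ => hpt i y).trans ?_
    rw [Finset.sum_ite, Finset.sum_const, Finset.sum_const, nsmul_eq_mul, nsmul_eq_mul]
    have ha : ((B.filter fun y => y ∈ mid L x m₀).card : ℝ) ≤ B.card := by
      exact_mod_cast Finset.card_filter_le _ _
    have hb : ((B.filter fun y => ¬ y ∈ mid L x m₀).card : ℝ) ≤ 2 * (m₀ * (L : ℝ) ^ m₀) := by
      have h1 : (B.filter fun y => ¬ y ∈ mid L x m₀).card ≤
          ((univ : Finset (Fin L → Bool)).filter fun y => y ∉ mid L x m₀).card :=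
        Finset.card_le_card (Finset.filter_subset_filter _ (Finset.subset_univ B))
      have h2 := card_notMid_le hL x m₀
      have h3 : ((B.filter fun y => ¬ y ∈ mid L x m₀).card : ℝ) ≤ ((2 * (m₀ * L ^ m₀) : ℕ) : ℝ) := by
        exact_mod_cast h1.trans h2
      push_cast at h3
      exact h3
    nlinarith
  -- assemble
  have hsum := card_goodCfg_le_sum x r A H
  have hsumR : ((goodCfg D x r).card : ℝ) ≤ ∑ S : PosSub D, ∑ y ∈ B,
      (count (base2 (i := S.1.min' S.2) x y) read2 (dom2 (S.1.min' S.2) fun ℓ => xor (x ℓ) (y ℓ)) r : ℝ) := by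
    exact_mod_cast hsum
  calc E * ((goodCfg D x r).card : ℝ)
      ≤ E * ∑ S : PosSub D, ∑ y ∈ B, (count (base2 (i := S.1.min' S.2) x y) read2
          (dom2 (S.1.min' S.2) fun ℓ => xor (x ℓ) (y ℓ)) r : ℝ) :=
        mul_le_mul_of_nonneg_left hsumR hEpos.le
    _ = ∑ S : PosSub D, E * ∑ y ∈ B, (count (base2 (i := S.1.min' S.2) x y) read2
          (dom2 (S.1.min' S.2) fun ℓ => xor (x ℓ) (y ℓ)) r : ℝ) := by rw [Finset.mul_sum]
    _ ≤ ∑ _S : PosSub D, ((B.card : ℝ) * c₁ + (2 * (m₀ * (L : ℝ) ^ m₀)) * c₂) :=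
        Finset.sum_le_sum fun S _ => hinner _
    _ = ((2 ^ (D + 1) - 1 : ℕ) : ℝ) * ((B.card : ℝ) * c₁ + (2 * (m₀ * (L : ℝ) ^ m₀)) * c₂) := by
        rw [Finset.sum_const, Finset.card_univ, card_posSub, nsmul_eq_mul]
    _ = ((2 ^ (D + 1) - 1 : ℕ) : ℝ) * (2 : ℝ) ^ (D * L) *
        ((B.card : ℝ) * (1 + E * (1 - 1 / (2 : ℝ) ^ D) ^ m₀) + E * (2 * (m₀ * (L : ℝ) ^ m₀))) := by
        rw [hc₁, hc₂]; ring

/-! ### Constants -/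

/-- The class `r` has at most `(2^L + 2)/3` elements. -/
theorem three_mul_card_cls_le (L r : ℕ) : 3 * ((cls L r).card : ℝ) ≤ (2 : ℝ) ^ L + 2 := by
  have h3 := abs_three_mul_card_filter_mod_sub_card_le (univ : Finset (Fin L → Bool)) r
  rw [norm_sum_omega3_pow_wt, Finset.card_univ, Fintype.card_fun, Fintype.card_bool,
    Fintype.card_fin] at h3
  push_cast at h3
  rw [abs_le] at h3
  have e : (univ.filter fun u : Fin L → Bool =>
      Literature.Computability.MetaComplexity.Hegedus.wt u % 3 = r % 3) = cls L r := rfl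
  rw [e] at h3
  linarith [h3.2]

/-- The thresholds `m₀(D, η)` and `L₀(D, η)`. -/
theorem exists_constants (D : ℕ) {η : ℝ} (hη : 0 < η) :
    ∃ m₀ L₀ : ℕ, 1 ≤ L₀ ∧ ∀ L : ℕ, L₀ ≤ L →
      (3 : ℝ) ^ (2 ^ (D + 1) - 1) * (1 - 1 / (2 : ℝ) ^ (D + 1)) ^ L ≤ η / 8 ∧
      (3 : ℝ) ^ (2 ^ (D + 1) - 2) * (1 - 1 / (2 : ℝ) ^ D) ^ m₀ ≤ η / 8 ∧
      (2 : ℝ) ≤ η / 8 * (2 : ℝ) ^ L ∧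
      ((2 ^ (D + 1) - 1 : ℕ) : ℝ) * (3 : ℝ) ^ (2 ^ (D + 1) - 1) * (2 * (m₀ * (L : ℝ) ^ m₀)) ≤
        η / 8 * (2 : ℝ) ^ L := by
  set M₁ : ℝ := (3 : ℝ) ^ (2 ^ (D + 1) - 1) with hM₁
  set M₂ : ℝ := (3 : ℝ) ^ (2 ^ (D + 1) - 2) with hM₂
  set q₁ : ℝ := 1 - 1 / (2 : ℝ) ^ (D + 1) with hq₁
  set q₂ : ℝ := 1 - 1 / (2 : ℝ) ^ D with hq₂
  have hM₁ : 0 < M₁ := by positivity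
  have hM₂ : 0 < M₂ := by positivity
  have hq₁0 : 0 ≤ q₁ := by
    rw [hq₁, sub_nonneg, div_le_one (by positivity)]; exact one_le_pow₀ (by norm_num)
  have hq₁1 : q₁ < 1 := by
    rw [hq₁]; have : (0 : ℝ) < 1 / (2 : ℝ) ^ (D + 1) := (by positivity); linarith
  have hq₂1 : q₂ < 1 := by
    rw [hq₂]; have : (0 : ℝ) < 1 / (2 : ℝ) ^ D := (by positivity); linarith
  -- `m₀`
  obtain ⟨m₀, hm₀⟩ := exists_pow_lt_of_lt_one (by positivity : 0 < η / 8 / M₂) hq₂1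
  -- `L` thresholds
  obtain ⟨N₁, hN₁⟩ := exists_pow_lt_of_lt_one (by positivity : 0 < η / 8 / M₁) hq₁1
  obtain ⟨N₂, hN₂⟩ := pow_unbounded_of_one_lt (16 / η) (by norm_num : (1 : ℝ) < 2)
  set C : ℝ := ((2 ^ (D + 1) - 1 : ℕ) : ℝ) * M₁ * (2 * m₀) with hC
  have hCnn : 0 ≤ C := by positivity
  have hev : ∀ᶠ n : ℕ in atTop, (n : ℝ) ^ m₀ * (1 / 2 : ℝ) ^ n < η / 8 / (C + 1) :=
    (tendsto_pow_const_mul_const_pow_of_abs_lt_one m₀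
      (by rw [abs_of_nonneg (by norm_num)]; norm_num : |(1 / 2 : ℝ)| < 1)).eventually
      (gt_mem_nhds (by positivity))
  obtain ⟨N₃, hN₃⟩ := Filter.eventually_atTop.1 hev
  refine ⟨m₀, max (max N₁ N₂) (max N₃ 1), le_trans (le_max_right _ _) (le_max_right _ _),
    fun L hL => ⟨?_, ?_, ?_, ?_⟩⟩
  · -- `M₁ q₁^L ≤ η/8`
    have hLN : N₁ ≤ L := le_trans (le_trans (le_max_left _ _) (le_max_left _ _)) hL
    have h1 : q₁ ^ L ≤ q₁ ^ N₁ := pow_le_pow_of_le_one hq₁0 hq₁1.le hLN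
    have h2 : M₁ * q₁ ^ N₁ < η / 8 := by rwa [lt_div_iff₀ hM₁, mul_comm] at hN₁
    nlinarith
  · -- `M₂ q₂^{m₀} ≤ η/8`
    have h2 : M₂ * q₂ ^ m₀ < η / 8 := by rwa [lt_div_iff₀ hM₂, mul_comm] at hm₀
    exact h2.le
  · -- `2 ≤ (η/8) 2^L`
    have hLN : N₂ ≤ L := le_trans (le_trans (le_max_right _ _) (le_max_left _ _)) hL
    have h1 : (2 : ℝ) ^ N₂ ≤ (2 : ℝ) ^ L := pow_le_pow_right₀ (by norm_num) hLN
    have h2 : 16 / η < (2 : ℝ) ^ L := hN₂.trans_le h1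
    rw [div_lt_iff₀ hη] at h2
    nlinarith
  · -- the polynomial tail
    have hLN : N₃ ≤ L := le_trans (le_trans (le_max_left _ _) (le_max_right _ _)) hL
    have h1 := hN₃ L hLN
    have h2pow : (0 : ℝ) < (2 : ℝ) ^ L := by positivity
    have e : (L : ℝ) ^ m₀ = (L : ℝ) ^ m₀ * (1 / 2 : ℝ) ^ L * (2 : ℝ) ^ L := by
      rw [mul_assoc, ← mul_pow]; norm_num
    have h3 : (L : ℝ) ^ m₀ ≤ η / 8 / (C + 1) * (2 : ℝ) ^ L := by
      rw [e]; exact mul_le_mul_of_nonneg_right h1.le h2pow.le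
    have hC1 : 0 < C + 1 := by linarith
    calc ((2 ^ (D + 1) - 1 : ℕ) : ℝ) * M₁ * (2 * (m₀ * (L : ℝ) ^ m₀)) = C * (L : ℝ) ^ m₀ := by
          rw [hC]; ring
      _ ≤ C * (η / 8 / (C + 1) * (2 : ℝ) ^ L) := mul_le_mul_of_nonneg_left h3 hCnn
      _ = (C / (C + 1)) * (η / 8 * (2 : ℝ) ^ L) := by field_simp
      _ ≤ 1 * (η / 8 * (2 : ℝ) ^ L) :=
          mul_le_mul_of_nonneg_right ((div_le_one hC1).2 (by linarith)) (by positivity)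
      _ = η / 8 * (2 : ℝ) ^ L := one_mul _

/-! ### `CubeCover` -/

/-- The final numeric contradiction (`e ∈ (0,1]`, `ε₁, ε₂ ≤ e/8`, small tail). -/
theorem numeric_contra {e X ε₁ ε₂ T MB : ℝ} (he0 : 0 < e) (he1 : e ≤ 1) (hX : 0 < X)
    (h1 : ε₁ ≤ e / 8) (h2 : ε₂ ≤ e / 8) (hε₂ : 0 ≤ ε₂) (h3 : 2 ≤ e / 8 * X) (h4 : T ≤ e / 8 * X)
    (hMB : 3 * MB ≤ (1 - e) * (X + 2)) (hmain : X * (1 - ε₁) ≤ 3 * MB * (1 + ε₂) + T) : False := by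
  have hR : 3 * MB * (1 + ε₂) ≤ (1 - e) * (X + 2) * (1 + ε₂) :=
    mul_le_mul_of_nonneg_right hMB (by linarith)
  have ha : (1 - e) * (X + 2) ≤ (1 - e) * (X + e / 8 * X) :=
    mul_le_mul_of_nonneg_left (by linarith) (by linarith)
  have hb : 0 ≤ (1 - e) * (X + e / 8 * X) := mul_nonneg (by linarith) (by positivity)
  have hR2 : (1 - e) * (X + 2) * (1 + ε₂) ≤ (1 - e) * (X + e / 8 * X) * (1 + e / 8) :=
    (mul_le_mul_of_nonneg_right ha (by linarith)).trans (mul_le_mul_of_nonneg_left (by linarith) hb)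
  have hpoly : (1 - e) * (1 + e / 8) * (1 + e / 8) + e / 8 < 1 - e / 8 := by
    nlinarith [mul_pos he0 he0, mul_pos (mul_pos he0 he0) he0]
  have hlow : X * (1 - e / 8) ≤ X * (1 - ε₁) := mul_le_mul_of_nonneg_left (by linarith) hX.le
  have hup : 3 * MB * (1 + ε₂) + T ≤ X * ((1 - e) * (1 + e / 8) * (1 + e / 8) + e / 8) := by
    have e1 : (1 - e) * (X + e / 8 * X) * (1 + e / 8) = X * ((1 - e) * (1 + e / 8) * (1 + e / 8)) := by
      ring
    linarith [hR, hR2, h4, e1]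
  have hlt : X * ((1 - e) * (1 + e / 8) * (1 + e / 8) + e / 8) < X * (1 - e / 8) :=
    mul_lt_mul_of_pos_left hpoly hX
  linarith

/-- **`CubeCover D η` for every `D` and every `η > 0`** (planner qa-qnc0-p1 T6(b)). -/
theorem cubeCover (D : ℕ) {η : ℝ} (hη : 0 < η) : CubeCover D η := by
  classical
  -- w.l.o.g. `η ≤ 1`
  have he0 : 0 < min η 1 := lt_min hη one_pos
  have he1 : min η 1 ≤ 1 := min_le_right _ _
  have heη : min η 1 ≤ η := min_le_left _ _
  obtain ⟨m₀, L₀, hL₀, hconst⟩ := exists_constants D he0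
  refine ⟨L₀, fun L hL r A hA hdens x => ?_⟩
  have hL1 : 1 ≤ L := le_trans hL₀ hL
  obtain ⟨h1, h2, h3, h4⟩ := hconst L hL
  by_contra hno
  push Not at hno
  have H : ∀ a : Fin L → (Fin (D + 1) → Bool), ∃ S : Finset (Fin (D + 1)), S.Nonempty ∧ vert x a S ∉ A := by
    intro a
    obtain ⟨S, hS, hSA⟩ := hno (fun i ℓ => a ℓ i)
    exact ⟨S, hS, by rwa [cubeVertex_transpose] at hSA⟩
  -- lower and upper bounds on `#goodCfg`
  have hLB := three_pow_mul_card_goodCfg_ge (D := D) x r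
  have hUB := card_goodCfg_le hL1 x r A m₀ H
  have hM1 : 2 ^ (D + 1) - 1 = (2 ^ (D + 1) - 2) + 1 := by
    have : 2 ≤ 2 ^ (D + 1) := by rw [pow_succ]; linarith [Nat.one_le_two_pow (n := D)]
    omega
  have h3pow : (3 : ℝ) ^ (2 ^ (D + 1) - 1) = 3 * (3 : ℝ) ^ (2 ^ (D + 1) - 2) := by
    rw [hM1, pow_succ, mul_comm]
  have h2pow : (2 : ℝ) ^ ((D + 1) * L) = (2 : ℝ) ^ L * (2 : ℝ) ^ (D * L) := by
    rw [← pow_add]; congr 1; ring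
  have hDL : (0 : ℝ) < (2 : ℝ) ^ (D * L) := by positivity
  have hε₂nn : 0 ≤ (3 : ℝ) ^ (2 ^ (D + 1) - 2) * (1 - 1 / (2 : ℝ) ^ D) ^ m₀ := by
    have hq0 : (0 : ℝ) ≤ 1 - 1 / (2 : ℝ) ^ D := by
      rw [sub_nonneg, div_le_one (by positivity)]; exact one_le_pow₀ (by norm_num)
    positivity
  -- the density hypothesis: `3·M·#B ≤ 3(1 − e)·#cls ≤ (1 − e)(2^L + 2)`
  have hMB : 3 * (((2 ^ (D + 1) - 1 : ℕ) : ℝ) * ((cls L r \ A).card : ℝ)) ≤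
      (1 - min η 1) * ((2 : ℝ) ^ L + 2) := by
    have hMcast : ((2 ^ (D + 1) - 1 : ℕ) : ℝ) = (2 : ℝ) ^ (D + 1) - 1 := by
      rw [Nat.cast_sub Nat.one_le_two_pow]; push_cast; ring
    rw [hMcast]
    have hd : ((2 : ℝ) ^ (D + 1) - 1) * ((cls L r \ A).card : ℝ) ≤
        (1 - min η 1) * ((cls L r).card : ℝ) :=
      hdens.trans (mul_le_mul_of_nonneg_right (by linarith) (by positivity))
    have hc := three_mul_card_cls_le L r
    have h3 : (1 - min η 1) * (3 * ((cls L r).card : ℝ)) ≤ (1 - min η 1) * ((2 : ℝ) ^ L + 2) :=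
      mul_le_mul_of_nonneg_left hc (by linarith)
    linarith
  -- combine the two counts: `2^L(1 − ε₁) ≤ 3·M·#B·(1 + ε₂) + T`
  have hmain : (2 : ℝ) ^ L * (1 - (3 : ℝ) ^ (2 ^ (D + 1) - 1) * (1 - 1 / (2 : ℝ) ^ (D + 1)) ^ L) ≤
      3 * (((2 ^ (D + 1) - 1 : ℕ) : ℝ) * ((cls L r \ A).card : ℝ)) *
          (1 + (3 : ℝ) ^ (2 ^ (D + 1) - 2) * (1 - 1 / (2 : ℝ) ^ D) ^ m₀) +
        ((2 ^ (D + 1) - 1 : ℕ) : ℝ) * (3 : ℝ) ^ (2 ^ (D + 1) - 1) * (2 * (m₀ * (L : ℝ) ^ m₀)) := by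
    refine le_of_mul_le_mul_left ?_ hDL
    calc (2 : ℝ) ^ (D * L) * ((2 : ℝ) ^ L *
          (1 - (3 : ℝ) ^ (2 ^ (D + 1) - 1) * (1 - 1 / (2 : ℝ) ^ (D + 1)) ^ L))
        = (2 : ℝ) ^ ((D + 1) * L) *
          (1 - (3 : ℝ) ^ (2 ^ (D + 1) - 1) * (1 - 1 / (2 : ℝ) ^ (D + 1)) ^ L) := by
          rw [h2pow]; ring
      _ ≤ (3 : ℝ) ^ (2 ^ (D + 1) - 1) * ((goodCfg D x r).card : ℝ) := hLB
      _ = 3 * ((3 : ℝ) ^ (2 ^ (D + 1) - 2) * ((goodCfg D x r).card : ℝ)) := by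
          rw [h3pow, mul_assoc]
      _ ≤ 3 * (((2 ^ (D + 1) - 1 : ℕ) : ℝ) * (2 : ℝ) ^ (D * L) *
          (((cls L r \ A).card : ℝ) * (1 + (3 : ℝ) ^ (2 ^ (D + 1) - 2) * (1 - 1 / (2 : ℝ) ^ D) ^ m₀) +
            (3 : ℝ) ^ (2 ^ (D + 1) - 2) * (2 * (m₀ * (L : ℝ) ^ m₀)))) :=
          mul_le_mul_of_nonneg_left hUB (by norm_num)
      _ = (2 : ℝ) ^ (D * L) * (3 * (((2 ^ (D + 1) - 1 : ℕ) : ℝ) * ((cls L r \ A).card : ℝ)) *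
          (1 + (3 : ℝ) ^ (2 ^ (D + 1) - 2) * (1 - 1 / (2 : ℝ) ^ D) ^ m₀) +
            ((2 ^ (D + 1) - 1 : ℕ) : ℝ) * (3 * (3 : ℝ) ^ (2 ^ (D + 1) - 2)) *
              (2 * (m₀ * (L : ℝ) ^ m₀))) := by ring
      _ = (2 : ℝ) ^ (D * L) * (3 * (((2 ^ (D + 1) - 1 : ℕ) : ℝ) * ((cls L r \ A).card : ℝ)) *
          (1 + (3 : ℝ) ^ (2 ^ (D + 1) - 2) * (1 - 1 / (2 : ℝ) ^ D) ^ m₀) +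
            ((2 ^ (D + 1) - 1 : ℕ) : ℝ) * (3 : ℝ) ^ (2 ^ (D + 1) - 1) *
              (2 * (m₀ * (L : ℝ) ^ m₀))) := by rw [h3pow]
  exact numeric_contra he0 he1 (by positivity) h1 h2 hε₂nn h3 h4 hMB hmain

/-- `CubeCover` at every degree and every `η > 0`. -/
theorem cubeCoverAll : CubeCoverAll := fun D _ hη => cubeCover D hη

end CubeChar

end Summit.QuantumAdvantage.AdviceFreeQNC0

end
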